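import Mathlib.Analysis.Calculus.SmoothSeries
import Literature.Analysis.FluidPDE.LacunaryScaleSums
import Literature.Analysis.FunctionSpaces.HolderInterpolation
import Literature.Analysis.FunctionSpaces.FlatTorus
import HarnessLib

/-!
# Lacunary series of smooth blocks: smoothness of the sum and the all-orders bounds
# `‖Dᵐ ∑ₖ vₖ‖_∞ ≲_m t^{-(m+1)/2}` from `‖Dᵐ vₖ‖_∞ ≲_m N_k^{1+m} e^{-cN_k²t}` ((3.13a))

Analysis/FluidPDE support file (all results proved; no definitions, no named facts) on the discharge
path of the named fact `Literature.Barriers.NavierStokesRegularity.CoiculescuPalasek2025_principalParts`.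
The principal parts of M. P. Coiculescu, S. Palasek, *Non-uniqueness of smooth solutions of the
Navier–Stokes equations from critical data*, Invent. Math. 244 (2025), arXiv:2503.14699, Def. 3.10,
are the lacunary series `v⁽ⁱ⁾ = ∑ₖ (v_k` or `v̄_k)`, and the first estimate of **Prop. 3.13**,

  (3.13a)  `‖∇ᵐ v⁽ⁱ⁾(t)‖_{L^∞} ≲_m t^{-(m+1)/2}`   for all `m ≥ 0`, `t > 0`,

is obtained from the block bounds `‖∇ᵐ v_k‖_{L^∞} ≲ N_k^{1+m} e^{-N_k²t}` (display (quack) of its proof)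
by summation over the lacunary scales. In the tree's rendering
(`CoiculescuPalasek2025.IsApproximateSolution.deriv_le`) (3.13a) reads
`eSupNorm (iteratedFDeriv ℝ m (Torus.lift (v t))) ≤ ENNReal.ofReal (K m * t ^ (-(m+1)/2))` with constants
`K : ℕ → ℝ` fixed BEFORE `t`. This file packages the passage from blocks to the series once and for all:

* `norm_iteratedFDeriv_tsum_le` — for a series of `C^N` functions with summable uniform bounds
  `‖Dᵏ fᵢ‖ ≤ v k i` on the derivatives (Mathlib's hypotheses of `iteratedFDeriv_tsum`), the sum
  obeys `‖Dᵏ(∑ᵢ fᵢ)(x)‖ ≤ ∑ᵢ v k i`;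
* `exists_norm_iteratedFDeriv_tsum_le_of_lacunary` — **(3.13a) from block bounds**: for `c > 0` and
  block constants `B : ℕ → ℝ` there is `K : ℕ → ℝ` (depending on `B`, `c` only) such that for EVERY
  positive scale sequence with `N_{i+1} ≥ 2N_i`, every `t > 0` and every family of smooth blocks
  `fᵢ : E → G` with `‖Dᵐ fᵢ(y)‖ ≤ B m · N_i^{m+1} e^{-cN_i²t}` for all `m, i, y`, the series `∑ᵢ fᵢ` is
  smooth and `‖Dᵐ(∑ᵢ fᵢ)(y)‖ ≤ K m · t^{-(m+1)/2}` for all `m, y` (the lacunary Gaussian sum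
  `∑ᵢ N_i^a e^{-cN_i²t} ≤ C_a t^{-a/2}` of `LacunaryScaleSums`);
* `contDiff_tsum_of_lacunary` — the smoothness alone;
* `eSupNorm_iteratedFDeriv_lift_tsum_le_of_lacunary` — the same for torus fields `vᵢ : T^d → G` in the
  `deriv_le` shape: `eSupNorm (iteratedFDeriv ℝ m (lift (∑ᵢ vᵢ))) ≤ ofReal (K m * t ^ (-(m+1)/2))`.

The blocks `v̄_k` of the paper, bounded by `N_k^{1+β₁+m} e^{-N_{k+1}²t} ≤ N_{k+1}^{1+m} e^{-N_{k+1}²t}`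
(`β₁ < b - 1`), are covered by the same statement for the shifted sequence `k ↦ N_{k+1}`.

## Mathlib / tree search

Mathlib: `iteratedFDeriv_tsum_apply`, `contDiff_tsum` (`Mathlib/Analysis/Calculus/SmoothSeries`),
`tsum_of_norm_bounded`. Tree: `summable_rpow_mul_exp_neg_of_lacunary`,
`exists_tsum_rpow_mul_exp_neg_le_of_lacunary` (`FluidPDE/LacunaryScaleSums`), `eSupNorm`,
`eSupNorm_le_ofReal` (`FunctionSpaces/HolderNorm`, `HolderInterpolation`), `Torus.lift` (`FlatTorus`).

## References

* M. P. Coiculescu, S. Palasek, Invent. Math. 244 (2025) 165–219, doi:10.1007/s00222-025-01396-z,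
  arXiv:2503.14699: Prop. 3.13 (3.13a) and its proof (display (quack)). [CoiculescuPalasek2025]
-/

noncomputable section

open Set Function Filter
open scoped BigOperators Topology ENNReal

namespace Literature.Analysis.FluidPDE

open Literature.Analysis.FunctionSpaces

/-! ## A series with summable derivative bounds: the bound on the sum -/

section Generic

variable {α E G : Type*} [NormedAddCommGroup E] [NormedSpace ℝ E]
  [NormedAddCommGroup G] [NormedSpace ℝ G] [CompleteSpace G]

/-- **Derivative bounds pass to the sum of a series**: under the hypotheses of Mathlib's
`iteratedFDeriv_tsum` (each `fᵢ` is `C^N`, and for `k ≤ N` the `k`-th derivatives are bounded by a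
summable `v k ·` uniformly in `x`), `‖Dᵏ(∑ᵢ fᵢ)(x)‖ ≤ ∑ᵢ v k i`. [folklore] -/
theorem norm_iteratedFDeriv_tsum_le {f : α → E → G} {v : ℕ → α → ℝ} {N : ℕ∞}
    (hf : ∀ i, ContDiff ℝ N (f i)) (hv : ∀ k : ℕ, (k : ℕ∞) ≤ N → Summable (v k))
    (h'f : ∀ (k : ℕ) (i : α) (x : E), (k : ℕ∞) ≤ N → ‖iteratedFDeriv ℝ k (f i) x‖ ≤ v k i)
    {k : ℕ} (hk : (k : ℕ∞) ≤ N) (x : E) :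
    ‖iteratedFDeriv ℝ k (fun y => ∑' i, f i y) x‖ ≤ ∑' i, v k i := by
  rw [iteratedFDeriv_tsum_apply hf hv h'f hk]
  exact tsum_of_norm_bounded (hv k hk).hasSum fun i => h'f k i x hk

end Generic

/-! ## Lacunary blocks: (3.13a) for the series -/

section Lacunary

variable {E G : Type*} [NormedAddCommGroup E] [NormedSpace ℝ E]
  [NormedAddCommGroup G] [NormedSpace ℝ G] [CompleteSpace G]

/-- **(3.13a) from block bounds.** For `c > 0` and block constants `B : ℕ → ℝ` there is
`K : ℕ → ℝ` such that: for every positive scale sequence `N` with `N_{i+1} ≥ 2N_i`, every `t > 0`, and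
every family of smooth blocks `fᵢ : E → G` obeying `‖Dᵐ fᵢ(y)‖ ≤ B m · N_i^{m+1} e^{-cN_i²t}` for all
`m, i, y`, the series `∑ᵢ fᵢ` is smooth and `‖Dᵐ(∑ᵢ fᵢ)(y)‖ ≤ K m · t^{-(m+1)/2}` for all `m`, `y`
("Because `N_k` grows rapidly, the sum is controlled by the largest summand, near `N_k = t^{-1/2}`").
[cite: CoiculescuPalasek2025, Prop. 3.13 (3.13a) and its proof] -/
theorem exists_norm_iteratedFDeriv_tsum_le_of_lacunary {c : ℝ} (hc : 0 < c) (B : ℕ → ℝ) :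
    ∃ K : ℕ → ℝ, ∀ (N : ℕ → ℝ), (∀ i, 0 < N i) → (∀ i, 2 * N i ≤ N (i + 1)) →
      ∀ t : ℝ, 0 < t → ∀ (f : ℕ → E → G), (∀ i, ContDiff ℝ ((⊤ : ℕ∞) : WithTop ℕ∞) (f i)) →
        (∀ (m i : ℕ) (y : E), ‖iteratedFDeriv ℝ m (f i) y‖ ≤
          B m * (N i ^ ((m : ℝ) + 1) * Real.exp (-(c * N i ^ 2 * t)))) →
        ContDiff ℝ ((⊤ : ℕ∞) : WithTop ℕ∞) (fun y => ∑' i, f i y) ∧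
          ∀ (m : ℕ) (y : E), ‖iteratedFDeriv ℝ m (fun y => ∑' i, f i y) y‖ ≤
            K m * t ^ (-(((m : ℝ) + 1) / 2)) := by
  -- the constants of the lacunary Gaussian sums, one for each order `m` (`a = m + 1`)
  have hex : ∀ m : ℕ, ∃ C : ℝ, 0 < C ∧ ∀ N : ℕ → ℝ, (∀ k, 0 < N k) → (∀ k, 2 * N k ≤ N (k + 1)) →
      ∀ t : ℝ, 0 < t → ∑' k, N k ^ ((m : ℝ) + 1) * Real.exp (-(c * N k ^ 2 * t)) ≤
        C * t ^ (-(((m : ℝ) + 1) / 2)) * Real.exp (-(c / 2 * N 0 ^ 2 * t)) :=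
    fun m => exists_tsum_rpow_mul_exp_neg_le_of_lacunary (a := (m : ℝ) + 1) (by positivity) hc
  choose C hC0 hC using hex
  refine ⟨fun m => |B m| * C m, fun N hN hlac t ht f hf hB => ?_⟩
  -- the summable bounds
  set v : ℕ → ℕ → ℝ := fun m i => B m * (N i ^ ((m : ℝ) + 1) * Real.exp (-(c * N i ^ 2 * t)))
    with hv
  have hBnonneg : ∀ m, 0 ≤ B m := by
    intro m
    have h := hB m 0 0
    have hpos : 0 < N 0 ^ ((m : ℝ) + 1) * Real.exp (-(c * N 0 ^ 2 * t)) := by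
      have := hN 0
      positivity
    nlinarith [norm_nonneg (iteratedFDeriv ℝ m (f 0) 0)]
  have hsum : ∀ m : ℕ, Summable (v m) := fun m =>
    (summable_rpow_mul_exp_neg_of_lacunary hN hlac (a := (m : ℝ) + 1) (by positivity) hc ht).mul_left
      (B m)
  have hv' : ∀ k : ℕ, ((k : ℕ∞) : ℕ∞) ≤ (⊤ : ℕ∞) → Summable (v k) := fun k _ => hsum k
  have h'f : ∀ (k i : ℕ) (x : E), ((k : ℕ∞) : ℕ∞) ≤ (⊤ : ℕ∞) →
      ‖iteratedFDeriv ℝ k (f i) x‖ ≤ v k i := fun k i x _ => hB k i x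
  refine ⟨contDiff_tsum (N := (⊤ : ℕ∞)) hf hv' h'f, fun m y => ?_⟩
  have h1 := norm_iteratedFDeriv_tsum_le (N := (⊤ : ℕ∞)) hf hv' h'f (k := m) le_top y
  refine h1.trans ?_
  -- `∑ᵢ v m i = B m ∑ᵢ N_i^{m+1} e^{-cN_i²t} ≤ B m · C m · t^{-(m+1)/2}`
  rw [hv, tsum_mul_left]
  have h2 := hC m N hN hlac t ht
  have hexp : Real.exp (-(c / 2 * N 0 ^ 2 * t)) ≤ 1 := by
    rw [Real.exp_le_one_iff, neg_nonpos]
    have := hN 0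
    positivity
  have hCt : 0 ≤ C m * t ^ (-(((m : ℝ) + 1) / 2)) := by
    have := hC0 m
    have : 0 ≤ t ^ (-(((m : ℝ) + 1) / 2)) := Real.rpow_nonneg ht.le _
    positivity
  have h3 : ∑' k, N k ^ ((m : ℝ) + 1) * Real.exp (-(c * N k ^ 2 * t)) ≤
      C m * t ^ (-(((m : ℝ) + 1) / 2)) := by
    refine h2.trans ?_
    calc C m * t ^ (-(((m : ℝ) + 1) / 2)) * Real.exp (-(c / 2 * N 0 ^ 2 * t))
        ≤ C m * t ^ (-(((m : ℝ) + 1) / 2)) * 1 := mul_le_mul_of_nonneg_left hexp hCt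
      _ = C m * t ^ (-(((m : ℝ) + 1) / 2)) := mul_one _
  calc B m * ∑' k, N k ^ ((m : ℝ) + 1) * Real.exp (-(c * N k ^ 2 * t))
      ≤ B m * (C m * t ^ (-(((m : ℝ) + 1) / 2))) := mul_le_mul_of_nonneg_left h3 (hBnonneg m)
    _ = |B m| * C m * t ^ (-(((m : ℝ) + 1) / 2)) := by rw [abs_of_nonneg (hBnonneg m)]; ring

/-- The smoothness part of `exists_norm_iteratedFDeriv_tsum_le_of_lacunary`, stated on its own:
a lacunary series of smooth blocks with the block bounds `‖Dᵐfᵢ‖ ≤ B m N_i^{m+1} e^{-cN_i²t}` (`t > 0`)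
has a smooth sum. [cite: CoiculescuPalasek2025, §5 ("`v⁽ⁱ⁾ ∈ C^∞((0,1] × 𝕋³)`")] -/
theorem contDiff_tsum_of_lacunary {c : ℝ} (hc : 0 < c) (B : ℕ → ℝ) {N : ℕ → ℝ}
    (hN : ∀ i, 0 < N i) (hlac : ∀ i, 2 * N i ≤ N (i + 1)) {t : ℝ} (ht : 0 < t) {f : ℕ → E → G}
    (hf : ∀ i, ContDiff ℝ ((⊤ : ℕ∞) : WithTop ℕ∞) (f i))
    (hB : ∀ (m i : ℕ) (y : E), ‖iteratedFDeriv ℝ m (f i) y‖ ≤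
      B m * (N i ^ ((m : ℝ) + 1) * Real.exp (-(c * N i ^ 2 * t)))) :
    ContDiff ℝ ((⊤ : ℕ∞) : WithTop ℕ∞) (fun y => ∑' i, f i y) := by
  obtain ⟨K, hK⟩ := exists_norm_iteratedFDeriv_tsum_le_of_lacunary (E := E) (G := G) hc B
  exact (hK N hN hlac t ht f hf hB).1

end Lacunary

/-! ## Torus fields: the `deriv_le` shape -/

section Torus

variable {d : Type*} [Fintype d]
variable {G : Type*} [NormedAddCommGroup G] [NormedSpace ℝ G] [CompleteSpace G]

omit [Fintype d] [NormedSpace ℝ G] [CompleteSpace G] in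
/-- The lift of a pointwise series is the series of the lifts. [folklore] -/
theorem lift_tsum_eq (v : ℕ → UnitAddTorus d → G) :
    Torus.lift (fun x => ∑' i, v i x) = fun y => ∑' i, Torus.lift (v i) y := rfl

/-- **(3.13a) in the tree's shape, from block bounds on the torus.** For `c > 0` and block constants
`B : ℕ → ℝ` there is `K : ℕ → ℝ` such that for every positive scale sequence with `N_{i+1} ≥ 2N_i`,
every `t > 0` and every family of smooth torus fields `vᵢ : T^d → G` whose lifts obey
`‖Dᵐ(vᵢ ∘ proj)(y)‖ ≤ B m · N_i^{m+1} e^{-cN_i²t}` (all `m, i, y`):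
`eSupNorm (iteratedFDeriv ℝ m (lift (∑ᵢ vᵢ))) ≤ ofReal (K m * t^{-(m+1)/2})` for every `m` — literally
the clause `IsApproximateSolution.deriv_le` for the field `x ↦ ∑ᵢ vᵢ x` at time `t`.
[cite: CoiculescuPalasek2025, Prop. 3.13 (3.13a)] -/
theorem exists_eSupNorm_iteratedFDeriv_lift_tsum_le_of_lacunary {c : ℝ} (hc : 0 < c) (B : ℕ → ℝ) :
    ∃ K : ℕ → ℝ, ∀ (N : ℕ → ℝ), (∀ i, 0 < N i) → (∀ i, 2 * N i ≤ N (i + 1)) →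
      ∀ t : ℝ, 0 < t → ∀ (v : ℕ → UnitAddTorus d → G), (∀ i, Torus.IsSmooth (v i)) →
        (∀ (m i : ℕ) (y : EuclideanSpace ℝ d), ‖iteratedFDeriv ℝ m (Torus.lift (v i)) y‖ ≤
          B m * (N i ^ ((m : ℝ) + 1) * Real.exp (-(c * N i ^ 2 * t)))) →
        Torus.IsSmooth (fun x => ∑' i, v i x) ∧
          ∀ m : ℕ, eSupNorm (iteratedFDeriv ℝ m (Torus.lift (fun x => ∑' i, v i x))) ≤
            ENNReal.ofReal (K m * t ^ (-(((m : ℝ) + 1) / 2))) := by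
  obtain ⟨K, hK⟩ := exists_norm_iteratedFDeriv_tsum_le_of_lacunary
    (E := EuclideanSpace ℝ d) (G := G) hc B
  refine ⟨K, fun N hN hlac t ht v hv hB => ?_⟩
  have h := hK N hN hlac t ht (fun i => Torus.lift (v i)) hv hB
  rw [Torus.IsSmooth, lift_tsum_eq]
  exact ⟨h.1, fun m => eSupNorm_le_ofReal fun y => h.2 m y⟩

end Torus

end Literature.Analysis.FluidPDE
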